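import Literature.AnabelianGeometry.SemiGraphs.Prop36HypothesesWitnessAffChart
import HarnessLib

/-!
# The one-vertex, edgeless semi-graph of anabelioids over ANY profinite group, with its explicit
# tempered fundamental group chart ([SemiAnbd] Prop. 3.6 / Thm. 3.7 hypothesis classes — witness infrastructure)

Mochizuki, *Semi-graphs of anabelioids*, Publ. RIMS **42** (2006) [MochizukiSemiAnbd2006], §2 Def. 2.3
(approximators, quasi-coherence, p. 24–25), Def. 2.4 (elevated / aloof / estranged / verticially slim, pp. 25–26),
§3 Def. 3.5 (i)(ii) (coverings, tempered coverings, p. 37), Prop. 3.6 (ii) (`B^temp(π₁^temp(𝒢)) ⥲ B^temp(𝒢)`,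
p. 38), Thm. 3.7 (i) (verticial subgroups, p. 40); [IUTchI] Rmk. 2.5.3 (i) (T2) (Galois-countability).

DEFINITIONS file of the abc-iut cell's §4(iii) NON-VACUITY LANE (seat abc-iut-L3-t2 gen 3; cell DEFS-FREEZE
convention «DEF NEW — reason» posted on STATUS; not a cone definition): a GENERIC version of seats
abc-iut-w5-d212 / abc-iut-w5-d236's `affWitness p` / `affChart p` (`Prop36HypothesesWitness.lean`,
`Prop36HypothesesWitnessAffChart.lean`, untouched and imported), with the vertex group `Aff(ℤ_p)` replaced by an
ARBITRARY profinite group `P` equipped with a `LevelFamily` — an `ℕ`-indexed family of open normal subgroups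
`N_n` with finite quotients of unbounded order forming a basis of neighbourhoods of `1` (for `Aff(ℤ_p)`: the
congruence subgroups `Γ_n`, `LevelFamily.padicAffine`). Contents:
* `OneVertex.graph P` — one vertex with anabelioid `B(P)`, no edges (`ProfiniteSemiGraph`);
* its Prop. 3.6 hypotheses given a level family and `IsSlimGroup P` (`OneVertex.prop36Hypotheses`), and Thm. 3.7
  hypotheses (`OneVertex.thm37Hypotheses`; totally estranged is vacuous — no edges);
* (companion `OneVertexWitnessChart.lean`:) EVERY covering is tempered, `B^temp(𝒢) ≌ B^temp(P)` by `S ↦ S_v`,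
  and the EXPLICIT chart `OneVertex.chart` with `π₁^temp(𝒢) = P` ON THE NOSE (given `SecondCountableTopology P`);
  the identity of `P` is a verticial homomorphism and the verticial subgroups are exactly `{⊤}`.
A witness certifies consistency only; no statement of the paper is touched, strengthened or assumed; no instance,
no notation, no `Prop` fact is declared. Nothing here bears on [IUTchIII] Cor. 3.12.
-/

noncomputable section

namespace Literature.AnabelianGeometry.SemiGraphs

namespace ProfiniteSemiGraph

open CategoryTheory Topology Literature.GroupTheory.SpecificGroups
open Literature.AlgebraicGeometry.Frobenioids (IsSlimGroup)
open Literature.AlgebraicGeometry.Frobenioids.QuasiTemperoid.BTempConnected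
  (hom_ext_apply ρ_one_apply ρ_mul_apply)

universe u

/-! ### Level families -/

/-- A *level family* on a topological group `P`: open normal subgroups `N_n` (`n : ℕ`) with finite quotients
`P/N_n` of unbounded order, every neighbourhood of `1` containing some `N_n` — the data that make the one-vertex
semi-graph of anabelioids `B(P)` quasi-coherent, totally elevated and Galois-countable (Def. 2.3 (iii), Def. 2.4 (i),
[IUTchI] Rmk. 2.5.3 (i) (T2)); e.g. the congruence subgroups of `Aff(ℤ_p)`.
[cite: MochizukiSemiAnbd2006, Def 2.3 pp.24-25] -/
structure LevelFamily (P : Type u) [Group P] [TopologicalSpace P] : Type u where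
  /-- the subgroups `N_n` -/
  N : ℕ → Subgroup P
  /-- they are normal -/
  normal : ∀ n, (N n).Normal
  /-- they are open -/
  isOpen : ∀ n, IsOpen (N n : Set P)
  /-- the quotients are finite -/
  finiteQuotient : ∀ n, Finite (P ⧸ N n)
  /-- every open neighbourhood of `1` contains some `N_n` -/
  basis : ∀ U : Set P, IsOpen U → (1 : P) ∈ U → ∃ n, (N n : Set P) ⊆ U
  /-- the quotients have unbounded order -/
  unbounded : ∀ M : ℕ, ∃ n, M ≤ Nat.card (P ⧸ N n)

/-- The congruence subgroups `Γ_n` of `Aff(ℤ_p)` form a level family (seat abc-iut-w5-d212's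
`PadicAffine.level` API). [cite: MochizukiSemiAnbd2006, Def 2.3 pp.24-25] -/
def LevelFamily.padicAffine (p : ℕ) [Fact p.Prime] : LevelFamily (PadicAffine p) where
  N := PadicAffine.level p
  normal := PadicAffine.level_normal
  isOpen := PadicAffine.isOpen_level
  finiteQuotient := PadicAffine.finite_quotient_level
  basis U hU h1 := by
    obtain ⟨n, -, hsub⟩ := PadicAffine.exists_level_subset hU h1
    exact ⟨n, hsub⟩
  unbounded M := ⟨M, ((Nat.lt_pow_self (Fact.out : p.Prime).one_lt).le).trans
    (PadicAffine.pow_le_card_quotient_level M)⟩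

namespace OneVertex

variable (P : Type u) [Group P] [TopologicalSpace P] [IsTopologicalGroup P] [CompactSpace P]
  [TotallyDisconnectedSpace P]

/-! ### The one-vertex, edgeless semi-graph of anabelioids with vertex group `P` -/

/-- The semi-graph with one vertex, no edges, no branches. [cite: MochizukiSemiAnbd2006, §1 p.11] -/
def ptSemiGraph : SemiGraph.{u} where
  Vertex := PUnit
  Edge := PEmpty
  Branch := PEmpty
  edgeOf := fun b => nomatch b
  abuts := fun b => nomatch b
  two_branches := fun e => nomatch e

/-- **The one-vertex witness over `P`**: one vertex with anabelioid `B(P)`, no edges.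
[cite: MochizukiSemiAnbd2006, Prop 3.6 p.38] -/
def graph : ProfiniteSemiGraph.{u} where
  graph := ptSemiGraph
  Gv := fun _ => P
  Ge := fun e => nomatch e
  groupE := fun e => nomatch e
  topologicalSpaceE := fun e => nomatch e
  isTopologicalGroupE := fun e => nomatch e
  compactSpaceE := fun e => nomatch e
  totallyDisconnectedSpaceE := fun e => nomatch e
  brHom := fun b => nomatch b

variable {P}

/-- The vertex group of the witness is `P` (definitionally). [cite: MochizukiSemiAnbd2006, Prop 3.6 p.38] -/
theorem graph_Gv (v : (graph P).graph.Vertex) : (graph P).Gv v = P := rfl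

/-- `P` is tempered (it is profinite; Rmk. 3.1.1). [cite: MochizukiSemiAnbd2006, Rmk 3.1.1 p.33] -/
theorem isTempered : IsTempered P := IsTempered.of_profinite

/-! ### The finite quotients `P/N_n` as objects and approximators -/

/-- The finite continuous `P`-set `P/N_n`, an object of `B^temp(P)` (Rmk. 3.1.2: `Π/H ∈ B^temp(Π)` iff `H` is open).
[cite: MochizukiSemiAnbd2006, Rmk 3.1.2 p.33] -/
def levelObj (L : LevelFamily P) (n : ℕ) : BTemp P :=
  ⟨Action.ofMulAction P (P ⧸ L.N n), (temperedAction_quotient_iff isTempered (L.N n)).mpr (L.isOpen n)⟩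

/-- A point of `P/N_n` fixed by `g` witnesses `g ∈ N_n` (`N_n` is normal). [cite: MochizukiSemiAnbd2006, Rmk 3.1.2 p.33] -/
theorem mem_level_of_fix (L : LevelFamily P) (n : ℕ) (x : (levelObj L n).obj.V) (g : P)
    (h : (levelObj L n).obj.ρ g x = x) : g ∈ L.N n := by
  haveI := L.normal n
  change P ⧸ L.N n at x
  induction x using QuotientGroup.induction_on with
  | H y =>
    change (g • (QuotientGroup.mk y : P ⧸ L.N n)) = QuotientGroup.mk y at h
    rw [MulAction.Quotient.smul_mk, QuotientGroup.eq, smul_eq_mul, mul_inv_rev, mul_assoc] at h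
    have h' : g⁻¹ ∈ L.N n := by
      have := (L.normal n).conj_mem _ h y
      simpa [mul_assoc] using this
    simpa using (L.N n).inv_mem h'

omit [IsTopologicalGroup P] [CompactSpace P] [TotallyDisconnectedSpace P] in
/-- Every finite continuous `P`-set is fixed pointwise by some `N_n` (the pointwise stabiliser is a finite
intersection of open sets containing `1`). [cite: MochizukiSemiAnbd2006, Rmk 3.1.1 p.33] -/
theorem exists_level_fixing (L : LevelFamily P) (X : BTemp P) [Finite X.obj.V] :
    ∃ n : ℕ, ∀ g ∈ L.N n, ∀ s : X.obj.V, X.obj.ρ g s = s := by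
  have hopen : IsOpen {g : P | ∀ s : X.obj.V, X.obj.ρ g s = s} := by
    have e : {g : P | ∀ s : X.obj.V, X.obj.ρ g s = s} = ⋂ s : X.obj.V, {g : P | X.obj.ρ g s = s} := by
      ext g; simp
    rw [e]
    exact isOpen_iInter_of_finite fun s => X.property.2 s
  have h1 : (1 : P) ∈ {g : P | ∀ s : X.obj.V, X.obj.ρ g s = s} := by
    intro s
    rw [map_one]
    rfl
  obtain ⟨n, hsub⟩ := L.basis _ hopen h1
  exact ⟨n, fun g hg s => hsub hg s⟩

/-- The **approximator at level `n`**: the finite quotient `P ↠ P/N_n` at the vertex (no edges, no branches).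
[cite: MochizukiSemiAnbd2006, Def 2.3 pp.24-25] -/
def levelApproximator (L : LevelFamily P) (n : ℕ) : (graph P).Approximator where
  FV := fun _ => P ⧸ L.N n
  FE := fun e => nomatch e
  groupFV := fun _ => @QuotientGroup.Quotient.group P _ (L.N n) (L.normal n)
  finiteFV := fun _ => L.finiteQuotient n
  groupFE := fun e => nomatch e
  finiteFE := fun e => nomatch e
  πV := fun _ => @QuotientGroup.mk' P _ (L.N n) (L.normal n)
  πE := fun e => nomatch e
  isOpen_ker_πV := fun _ => by
    haveI := L.normal n
    change IsOpen ((QuotientGroup.mk' (L.N n)).ker : Set P)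
    rw [QuotientGroup.ker_mk']
    exact L.isOpen n
  isOpen_ker_πE := fun e => nomatch e
  brF := fun b => nomatch b
  brF_injective := fun b => nomatch b
  comm := fun b => nomatch b
  bounded := ⟨Nat.card (P ⧸ L.N n), @Nat.card_pos _ ⟨QuotientGroup.mk (1 : P)⟩ (L.finiteQuotient n),
    fun _ => dvd_rfl⟩

/-- The level approximators are `π₁`-epimorphic. [cite: MochizukiSemiAnbd2006, Def 2.3(ii) p.25] -/
theorem levelApproximator_isPiOneEpimorphic (L : LevelFamily P) (n : ℕ) : (levelApproximator L n).IsPiOneEpimorphic :=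
  haveI := L.normal n
  ⟨fun _ => QuotientGroup.mk'_surjective (L.N n), fun e => nomatch e⟩

/-- The kernel of the level-`n` approximator at the vertex is `N_n`. [cite: MochizukiSemiAnbd2006, Def 2.3 pp.24-25] -/
theorem levelApproximator_πV_eq_one_iff (L : LevelFamily P) (n : ℕ) (v : (graph P).graph.Vertex) (g : P) :
    (levelApproximator L n).πV v g = 1 ↔ g ∈ L.N n := by
  haveI := L.normal n
  change (QuotientGroup.mk' (L.N n)) g = 1 ↔ _
  exact QuotientGroup.eq_one_iff g

/-! ### The conjuncts of `Prop36Hypotheses`, and `Thm37Hypotheses` -/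

/-- Connected: the barycentric subdivision has one point. [cite: MochizukiSemiAnbd2006, §1 p.11] -/
theorem isConnected : (graph P).IsConnected := by
  refine ⟨@SimpleGraph.Connected.mk _ _ ?_ ⟨Sum.inl PUnit.unit⟩⟩
  intro a b
  rcases a with a | a | a
  · rcases b with b | b | b
    · exact SimpleGraph.Reachable.refl _
    · exact nomatch b
    · exact nomatch b
  · exact nomatch a
  · exact nomatch a

/-- Countable. [cite: MochizukiSemiAnbd2006, §1 p.11] -/
theorem isCountable : (graph P).IsCountable :=
  ⟨inferInstanceAs (Countable PUnit), inferInstanceAs (Countable PEmpty)⟩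

/-- Has a vertex. [cite: MochizukiSemiAnbd2006, Thm 3.7 p.40] -/
theorem hasVertex : (graph P).HasVertex := ⟨PUnit.unit⟩

/-- Of injective type (no branches). [cite: MochizukiSemiAnbd2006, Def 2.1 p.22] -/
theorem isOfInjectiveType : (graph P).IsOfInjectiveType := fun b => nomatch b

/-- Totally aloof (no edges). [cite: MochizukiSemiAnbd2006, Def 2.4(iv) p.26] -/
theorem isTotallyAloof : (graph P).IsTotallyAloof := fun e => nomatch e

/-- Totally estranged (no edges). [cite: MochizukiSemiAnbd2006, Def 2.4(iv) p.26] -/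
theorem isTotallyEstranged : (graph P).IsTotallyEstranged := fun e => nomatch e

/-- Verticially slim iff `P` is slim. [cite: MochizukiSemiAnbd2006, Def 2.4(ii) p.25] -/
theorem isVerticiallySlim (hslim : IsSlimGroup P) : (graph P).IsVerticiallySlim := fun _ => hslim

/-- Totally elevated: some approximator `P/N_n` has order `≥ M`, and there is no edge group to avoid.
[cite: MochizukiSemiAnbd2006, Def 2.4(i) p.25] -/
theorem isTotallyElevated (L : LevelFamily P) : (graph P).IsTotallyElevated := by
  intro v M
  obtain ⟨n, hn⟩ := L.unbounded M
  haveI := L.normal n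
  refine ⟨levelApproximator L n, levelApproximator_isPiOneEpimorphic L n, ⊤, ?_, fun b => nomatch b⟩
  haveI := L.finiteQuotient n
  calc M ≤ Nat.card (P ⧸ L.N n) := hn
    _ = Nat.card (⊤ : Subgroup (P ⧸ L.N n)) := Subgroup.card_top.symm

/-- Quasi-coherent: a finite continuous `P`-set is fixed by some `N_n`, i.e. split by the approximator of level
`n`. [cite: MochizukiSemiAnbd2006, Def 2.3(iii) p.25] -/
theorem isQuasiCoherent (L : LevelFamily P) : (graph P).IsQuasiCoherent := by
  intro M HV HE hV _hE
  haveI : Finite (HV PUnit.unit).obj.V := (hV PUnit.unit).2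
  obtain ⟨n, hfix⟩ := exists_level_fixing L (HV PUnit.unit)
  refine ⟨levelApproximator L n, ?_, fun e => nomatch e⟩
  intro v g hg x
  rcases v with ⟨⟩
  exact hfix g ((levelApproximator_πV_eq_one_iff L n _ g).mp hg) x

/-- The finite covering of the witness with vertex fibre `P/N_n`. [cite: Mochizuki2012, IUTchI Rmk 2.5.3 (i) (T2), p. 52] -/
def levelCov (L : LevelFamily P) (n : ℕ) : CovObj (graph P) where
  SV := fun _ => levelObj L n
  SE := fun e => nomatch e
  glue := fun b => nomatch b

/-- The level coverings are finite. [cite: Mochizuki2012, IUTchI Rmk 2.5.3 (i) (T2), p. 52] -/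
theorem levelCov_isFinite (L : LevelFamily P) (n : ℕ) : (levelCov L n).IsFinite :=
  ⟨fun _ => L.finiteQuotient n, fun e => nomatch e⟩

/-- The level coverings have nonempty fibres. [cite: Mochizuki2012, IUTchI Rmk 2.5.3 (i) (T2), p. 52] -/
theorem levelCov_hasNonemptyFibres (L : LevelFamily P) (n : ℕ) : (levelCov L n).HasNonemptyFibres :=
  ⟨fun _ => ⟨QuotientGroup.mk (1 : P)⟩, fun e => nomatch e⟩

/-- Galois-countable ([IUTchI] Rmk. 2.5.3 (i) (T2)): every finite covering is split, over the vertex anabelioid,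
by some `P/N_n`. [cite: Mochizuki2012, IUTchI Rmk 2.5.3 (i) (T2), p. 52] -/
theorem isGaloisCountable (L : LevelFamily P) : (graph P).IsGaloisCountable := by
  refine ⟨isCountable, levelCov L, fun n => ⟨levelCov_isFinite L n, levelCov_hasNonemptyFibres L n⟩,
    fun H hH => ?_⟩
  haveI : Finite (H.SV PUnit.unit).obj.V := hH.finite_V PUnit.unit
  obtain ⟨n, hfix⟩ := exists_level_fixing L (H.SV PUnit.unit)
  refine ⟨n, fun v x g hgx s => ?_, fun e => nomatch e⟩
  rcases v with ⟨⟩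
  exact hfix g (mem_level_of_fix L n x g hgx) s

/-- **The one-vertex witness over a slim profinite `P` with a level family satisfies the hypotheses of
[SemiAnbd] Proposition 3.6.** [cite: MochizukiSemiAnbd2006, Prop 3.6 p.38] -/
theorem prop36Hypotheses (L : LevelFamily P) (hslim : IsSlimGroup P) : (graph P).Prop36Hypotheses where
  isConnected := isConnected
  isCountable := isCountable
  isGaloisCountable := isGaloisCountable L
  hasVertex := hasVertex
  isOfInjectiveType := isOfInjectiveType
  isQuasiCoherent := isQuasiCoherent L
  isTotallyElevated := isTotallyElevated L
  isTotallyAloof := isTotallyAloof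
  isVerticiallySlim := isVerticiallySlim hslim

/-- **… and the hypotheses of [SemiAnbd] Theorem 3.7.** [cite: MochizukiSemiAnbd2006, Thm 3.7 p.40] -/
theorem thm37Hypotheses (L : LevelFamily P) (hslim : IsSlimGroup P) : (graph P).Thm37Hypotheses where
  toProp36Hypotheses := prop36Hypotheses L hslim
  isTotallyEstranged := isTotallyEstranged

end OneVertex

end ProfiniteSemiGraph

end Literature.AnabelianGeometry.SemiGraphs

end
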